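import Literature.AlgebraicGeometry.Resolution.QuadraticTransformColength
import Literature.AlgebraicGeometry.Resolution.QuadraticTransformsKeyLemma
import Literature.AlgebraicGeometry.Resolution.RegularSystemOfParameters
import Literature.AlgebraicGeometry.Resolution.RegularCentreBlowupOrder
import Mathlib.Algebra.Polynomial.Roots
import HarnessLib

/-!
# An initial form of degree `r` has at most `r` linear factors: good chart parameters exist

Topic: `Literature/AlgebraicGeometry/Resolution`. The bookkeeping behind the choice of a
"generic" element of `𝔪 ∖ 𝔪²` in Zariski's theory of base points on a two-dimensional regular
local ring `(R, 𝔪)` (Zariski–Samuel II, App. 5; Huneke–Swanson 2006, Lemma 14.3.4, whose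
hypothesis is "`f ∈ I` of order `r` with `f ∉ (x) + 𝔪^{r+1}`", `length_quotient_transform_lt_of_not_mem`
of `QuadraticTransformColength.lean`): for `𝔪 = (u, v)` and an element `f` of order exactly `r ≥ 1`,
the elements `x_t = u + tv` FAIL the condition `f ∉ (x_t) + 𝔪^{r+1}` for at most `r` residue classes
of `t` — the class `t̄ ∈ κ = R/𝔪` fails iff the linear form `U + t̄V` divides the initial form
`F̄ ∈ κ[U, V]` of `f` (quasi-regularity of the regular system of parameters, Matsumura Thm. 17.10,
`coeff_mem_maximalIdeal_of_eval_mem_pow`), and a non-zero binary form of degree `r` vanishes at no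
more than `r` points `(−t̄ : 1)` of the line. PROVED:

* `add_mul_not_mem_sq` — `u + tv ∉ 𝔪²` for a regular system of parameters `(u, v)` of a
  two-dimensional regular local ring;
* `mem_pow_pred_of_mul_mem_pow` — `x g ∈ 𝔪^r`, `x ∉ 𝔪²` forces `g ∈ 𝔪^{r−1}`;
* `dehomLine`, `eval_dehomLine`, `dehomLine_ne_zero`, `natDegree_dehomLine_le` — dehomogenising
  a binary form: `F̄(s, 1)` is the value at `s` of a one-variable polynomial of degree `≤ r` built
  from the coefficients of `F̄`, non-zero if `F̄ ≠ 0`;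
* `card_le_of_forall_mem_span_sup_pow` — **the theorem**: if `f ∈ 𝔪^r ∖ 𝔪^{r+1}` lies in
  `(u + tv) + 𝔪^{r+1}` for every `t` in a finite set `T ⊆ R` of pairwise incongruent elements
  modulo `𝔪`, then `|T| ≤ r`.

## References

* O. Zariski, P. Samuel, *Commutative Algebra* II (1960), Appendix 5. [ZariskiSamuel1960]
* C. Huneke, I. Swanson, *Integral Closure of Ideals, Rings, and Modules* (2006), Lemma 14.3.4.
  [HunekeSwanson2006]
* H. Matsumura, *Commutative Ring Theory* (1986), Thm. 17.10. [Matsumura1987]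
-/

noncomputable section

open IsLocalRing MvPolynomial Polynomial

namespace Literature.AlgebraicGeometry.Resolution

universe u

variable {R : Type u} [CommRing R]

/-! ## Regular systems of parameters `(u, v)` of a two-dimensional regular local ring -/

section Rsop

variable [IsRegularLocalRing R]

/-- For `𝔪 = (u, v)` not principal, `u + tv ∉ 𝔪²` (else `𝔪 = (v) + 𝔪²`, so `𝔪 = (v)` by
Nakayama). [folklore] -/
theorem add_mul_not_mem_sq (hdim : ringKrullDim R = 2) {u v : R}
    (huv : maximalIdeal R = Ideal.span {u, v}) (t : R) : u + t * v ∉ maximalIdeal R ^ 2 := by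
  intro h2
  apply maximalIdeal_ne_span_singleton hdim v
  refine le_antisymm ?_ ((Ideal.span_singleton_le_iff_mem _).mpr
    (huv ▸ Ideal.subset_span (by simp)))
  refine Submodule.le_of_le_smul_of_le_jacobson_bot (IsNoetherian.noetherian _)
    (maximalIdeal_le_jacobson _) ?_
  conv_lhs => rw [huv]
  rw [Ideal.span_le]
  intro z hz
  rcases hz with hz | hz
  · -- `u = (u + t v) - t v`
    have e : z = (u + t * v) + (-t) * v := by rw [hz]; ring
    rw [SetLike.mem_coe, e]
    refine Submodule.add_mem _ (Submodule.mem_sup_right ?_)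
      (Submodule.mem_sup_left (Ideal.mul_mem_left _ _ (Ideal.mem_span_singleton_self _)))
    rw [Ideal.smul_eq_mul, ← pow_two]
    exact h2
  · rw [Set.mem_singleton_iff] at hz
    rw [SetLike.mem_coe, hz]
    exact Submodule.mem_sup_left (Ideal.mem_span_singleton_self _)

/-- **`x g ∈ 𝔪^r` with `x ∉ 𝔪²` forces `g ∈ 𝔪^{r−1}`** (the `𝔪`-adic order of a regular local
ring is additive on `x`; `span_singleton_inf_pow_le`). [cite: ZariskiSamuel1960, Ch. VIII §1] -/
theorem mem_pow_pred_of_mul_mem_pow {x g : R} (hx2 : x ∉ maximalIdeal R ^ 2) (hx0 : x ≠ 0) {r : ℕ}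
    (h : x * g ∈ maximalIdeal R ^ r) : g ∈ maximalIdeal R ^ (r - 1) := by
  haveI := isDomain_of_isRegularLocalRing R
  have hmem : x * g ∈ Ideal.span {x} ⊓ maximalIdeal R ^ r :=
    ⟨Ideal.mul_mem_right _ _ (Ideal.mem_span_singleton_self _), h⟩
  have h2 := span_singleton_inf_pow_le hx2 r hmem
  obtain ⟨e, he, hxe⟩ := Ideal.mem_span_singleton_mul.mp h2
  have heg : e = g := mul_right_injective₀ hx0 hxe
  rw [heg] at he
  exact he

end Rsop

/-! ## Dehomogenising a binary form -/

section Line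

variable {k : Type u} [CommRing k]

/-- The exponent vector `(i, r − i)` on `Fin 2`. [folklore] -/
def lineExp (r i : ℕ) : Fin 2 →₀ ℕ :=
  Finsupp.single 0 i + Finsupp.single 1 (r - i)

/-- First component of `(i, r − i)`. [folklore] -/
@[simp] theorem lineExp_zero (r i : ℕ) : lineExp r i 0 = i := by
  simp [lineExp]

/-- Second component of `(i, r − i)`. [folklore] -/
@[simp] theorem lineExp_one (r i : ℕ) : lineExp r i 1 = r - i := by
  simp [lineExp]

/-- `i ↦ (i, r − i)` is injective. [folklore] -/
theorem lineExp_injective (r : ℕ) : Function.Injective (lineExp r) := fun i j h => by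
  have := congrArg (fun m => m 0) h
  simpa using this

/-- The weight-one degree of an exponent vector on `Fin 2`. [folklore] -/
theorem weight_one_fin_two (m : Fin 2 →₀ ℕ) : Finsupp.weight (1 : Fin 2 → ℕ) m = m 0 + m 1 := by
  rw [Finsupp.weight_apply, Finsupp.sum_fintype _ _ (by simp), Fin.sum_univ_two]
  simp

/-- A monomial of a binary form of degree `r` is `(i, r − i)` with `i ≤ r`. [folklore] -/
theorem eq_lineExp_of_degree {m : Fin 2 →₀ ℕ} {r : ℕ} (hsum : m 0 + m 1 = r) :
    m 0 ≤ r ∧ m = lineExp r (m 0) := by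
  refine ⟨by omega, ?_⟩
  ext j
  fin_cases j
  · simp
  · simp [lineExp]; omega

/-- **Dehomogenisation of a binary form**: the one-variable polynomial
`∑_{i ≤ r} (coeff_{(i, r−i)} F) X^i`. [folklore] -/
def dehomLine (r : ℕ) (F : MvPolynomial (Fin 2) k) : k[X] :=
  ∑ i ∈ Finset.range (r + 1), Polynomial.C (F.coeff (lineExp r i)) * Polynomial.X ^ i

/-- The coefficients of the dehomogenisation. [folklore] -/
theorem coeff_dehomLine (r : ℕ) (F : MvPolynomial (Fin 2) k) (i : ℕ) (hi : i ≤ r) :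
    (dehomLine r F).coeff i = F.coeff (lineExp r i) := by
  rw [dehomLine, Polynomial.finsetSum_coeff]
  simp only [Polynomial.coeff_C_mul_X_pow]
  rw [Finset.sum_eq_single i]
  · simp
  · intro j _ hji; simp [Ne.symm hji]
  · intro h; exfalso; exact h (Finset.mem_range.mpr (by omega))

/-- The dehomogenisation has degree `≤ r`. [folklore] -/
theorem natDegree_dehomLine_le (r : ℕ) (F : MvPolynomial (Fin 2) k) :
    (dehomLine r F).natDegree ≤ r := by
  rw [dehomLine]
  refine Polynomial.natDegree_sum_le_of_forall_le _ _ fun i hi => ?_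
  exact (Polynomial.natDegree_C_mul_X_pow_le _ _).trans (by
    have := Finset.mem_range.mp hi; omega)

/-- **`F(s, 1)` is the value of the dehomogenisation at `s`** for a form `F` of degree `r`.
[folklore] -/
theorem eval_dehomLine {r : ℕ} {F : MvPolynomial (Fin 2) k} (hF : F.IsHomogeneous r) (s : k) :
    (dehomLine r F).eval s = MvPolynomial.eval ![s, 1] F := by
  classical
  rw [MvPolynomial.eval_eq']
  -- reindex the sum over the support through `i ↦ (i, r - i)`
  have hsupp : ∀ m ∈ F.support, m 0 ≤ r ∧ m = lineExp r (m 0) := fun m hm =>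
    eq_lineExp_of_degree (by rw [← weight_one_fin_two]; exact hF (mem_support_iff.mp hm))
  have h1 : ∑ d ∈ F.support, F.coeff d * ∏ i, (![s, 1] : Fin 2 → k) i ^ d i =
      ∑ d ∈ (Finset.range (r + 1)).image (lineExp r), F.coeff d * s ^ d 0 := by
    apply Finset.sum_subset_zero_on_sdiff
    · intro m hm
      obtain ⟨hle, heq⟩ := hsupp m hm
      exact Finset.mem_image.mpr ⟨m 0, Finset.mem_range.mpr (by omega), heq.symm⟩
    · intro m hm
      rw [Finset.mem_sdiff] at hm
      rw [notMem_support_iff.mp hm.2, zero_mul]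
    · intro m hm
      rw [Fin.prod_univ_two]
      simp
  rw [h1, Finset.sum_image (fun i _ j _ h => lineExp_injective r h), dehomLine,
    Polynomial.eval_finsetSum]
  refine Finset.sum_congr rfl fun i _ => ?_
  simp

end Line

/-- The dehomogenisation of a non-zero binary form of degree `r` is non-zero. [folklore] -/
theorem dehomLine_ne_zero {k : Type u} [CommRing k] {r : ℕ} {F : MvPolynomial (Fin 2) k}
    (hF : F.IsHomogeneous r) (hF0 : F ≠ 0) : dehomLine r F ≠ 0 := by
  obtain ⟨m, hm⟩ := MvPolynomial.ne_zero_iff.mp hF0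
  obtain ⟨hle, heq⟩ := eq_lineExp_of_degree (m := m) (r := r)
    (by rw [← weight_one_fin_two]; exact hF hm)
  intro h0
  have := coeff_dehomLine r F (m 0) hle
  rw [h0, Polynomial.coeff_zero, ← heq] at this
  exact hm this.symm

/-! ## The theorem -/

section Main

variable [IsRegularLocalRing R]

/-- **A form of order `r` lies in `(u + tv) + 𝔪^{r+1}` for at most `r` residue classes of `t`**
(Zariski–Samuel II, App. 5; the hypothesis "`f ∉ (x) + 𝔪^{r+1}`" of Huneke–Swanson's Lemma
14.3.4 holds for `x = u + tv` and all but `≤ r` classes `t̄`): let `(R, 𝔪)` be a two-dimensional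
regular local ring with `𝔪 = (u, v)`, `f ∈ 𝔪^r ∖ 𝔪^{r+1}` (`r ≥ 1`), and `T ⊆ R` a finite set of
pairwise incongruent elements modulo `𝔪` such that `f ∈ (u + tv) + 𝔪^{r+1}` for every `t ∈ T`.
Then `|T| ≤ r`. Proof: writing `f = (u + tv)g + h` forces `g ∈ 𝔪^{r−1}`; by quasi-regularity of
`(u, v)` the initial form `F̄ ∈ κ[U, V]` of `f` is `(U + t̄V)·Ḡ`, so `F̄(−t̄, 1) = 0`; and the
non-zero polynomial `F̄(Y, 1)` of degree `≤ r` has at most `r` roots.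
[cite: ZariskiSamuel1960, Appendix 5] -/
theorem card_le_of_forall_mem_span_sup_pow (hdim : ringKrullDim R = 2) {u v : R}
    (huv : maximalIdeal R = Ideal.span {u, v}) {r : ℕ} (hr : 1 ≤ r) {f : R}
    (hfr : f ∈ maximalIdeal R ^ r) (hf : f ∉ maximalIdeal R ^ (r + 1)) (T : Finset R)
    (hT : ∀ t ∈ T, ∀ t' ∈ T, t ≠ t' → t - t' ∉ maximalIdeal R)
    (hbad : ∀ t ∈ T, f ∈ Ideal.span {u + t * v} ⊔ maximalIdeal R ^ (r + 1)) : T.card ≤ r := by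
  classical
  haveI := isDomain_of_isRegularLocalRing R
  -- the regular system of parameters `c = (u, v)`
  let c : Fin 2 → R := ![u, v]
  have hc0 : c 0 = u := rfl
  have hc1 : c 1 = v := rfl
  have hrange : Set.range c = {u, v} := by
    ext z
    simp only [Set.mem_range, Set.mem_insert_iff, Set.mem_singleton_iff]
    constructor
    · rintro ⟨i, rfl⟩
      fin_cases i
      · exact Or.inl rfl
      · exact Or.inr rfl
    · rintro (rfl | rfl)
      exacts [⟨0, rfl⟩, ⟨1, rfl⟩]
  have hc : Ideal.span (Set.range c) = maximalIdeal R := by rw [hrange, huv]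
  have hd : (maximalIdeal R).spanFinrank = 2 := by
    have := (isRegularLocalRing_iff R).mp ‹_›
    rw [hdim] at this
    exact_mod_cast this
  have hcm : ∀ l, c l ∈ maximalIdeal R := fun l => hc ▸ Ideal.subset_span ⟨l, rfl⟩
  -- the initial form of `f`
  obtain ⟨F, hF, hFf⟩ := exists_isHomogeneous_of_mem_span_pow c r (by rw [hc]; exact hfr)
  let Fbar : MvPolynomial (Fin 2) (ResidueField R) := MvPolynomial.map (residue R) F
  have hFbar : Fbar.IsHomogeneous r := hF.map _
  have hFbar0 : Fbar ≠ 0 :=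
    map_residue_ne_zero_of_eval_not_mem_pow_succ c hcm hF (by rw [hFf]; exact hf)
  -- for each `t ∈ T`, `F̄` vanishes at `(-t̄, 1)`
  have hroot : ∀ t ∈ T, MvPolynomial.eval ![-(residue R t), 1] Fbar = 0 := by
    intro t ht
    -- `f = (u + t v) g + b` with `b ∈ 𝔪^{r+1}`
    obtain ⟨a, ha, b, hb, hab⟩ := Submodule.mem_sup.mp (hbad t ht)
    obtain ⟨g, rfl⟩ := Ideal.mem_span_singleton'.mp ha
    have hxt2 : u + t * v ∉ maximalIdeal R ^ 2 := add_mul_not_mem_sq hdim huv t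
    have hxt0 : u + t * v ≠ 0 := fun h0 => hxt2 (h0 ▸ Submodule.zero_mem _)
    -- `g ∈ 𝔪^{r-1}`
    have hg : g ∈ maximalIdeal R ^ (r - 1) := by
      apply mem_pow_pred_of_mul_mem_pow hxt2 hxt0
      have e : (u + t * v) * g = f - b := by rw [← hab]; ring
      rw [e]
      exact Ideal.sub_mem _ hfr (Ideal.pow_le_pow_right (Nat.le_succ r) hb)
    obtain ⟨G, hG, hGg⟩ := exists_isHomogeneous_of_mem_span_pow c (r - 1) (by rw [hc]; exact hg)
    -- `H = F - (X₀ + t X₁) G` is a form of degree `r` with value `b ∈ 𝔪^{r+1}`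
    let L : MvPolynomial (Fin 2) R := MvPolynomial.X 0 + MvPolynomial.C t * MvPolynomial.X 1
    have hL : L.IsHomogeneous 1 :=
      (isHomogeneous_X R 0).add ((isHomogeneous_C _ t).mul (isHomogeneous_X R 1))
    have hH : (F - L * G).IsHomogeneous r := by
      have h1 := hL.mul hG
      rw [show 1 + (r - 1) = r by omega] at h1
      exact hF.sub h1
    have hHval : MvPolynomial.eval c (F - L * G) ∈ maximalIdeal R ^ (r + 1) := by
      have e : MvPolynomial.eval c (F - L * G) = b := by
        simp only [map_sub, map_mul, map_add, MvPolynomial.eval_X, MvPolynomial.eval_C, hFf,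
          hGg, L, hc0, hc1]
        rw [← hab]
        ring
      rw [e]; exact hb
    -- all coefficients of `H` lie in `𝔪`: `H̄ = 0`
    have hHbar : MvPolynomial.map (residue R) (F - L * G) = 0 := by
      ext mono
      rw [MvPolynomial.coeff_map, MvPolynomial.coeff_zero, IsLocalRing.residue_eq_zero_iff]
      exact coeff_mem_maximalIdeal_of_eval_mem_pow hd c hc hH hHval mono
    -- hence `F̄ = (X₀ + t̄ X₁) Ḡ`, which vanishes at `(-t̄, 1)`
    have hfac : Fbar = (MvPolynomial.X 0 + MvPolynomial.C (residue R t) * MvPolynomial.X 1) *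
        MvPolynomial.map (residue R) G := by
      rw [map_sub, sub_eq_zero, map_mul] at hHbar
      rw [show Fbar = MvPolynomial.map (residue R) F from rfl, hHbar]
      congr 1
      simp only [L, map_add, map_mul, MvPolynomial.map_X, MvPolynomial.map_C]
    rw [hfac, map_mul]
    simp
  -- the one-variable polynomial `q = F̄(Y, 1)`: non-zero of degree `≤ r`, vanishing at `|T|` points
  set q := dehomLine r Fbar with hq
  have hq0 : q ≠ 0 := dehomLine_ne_zero hFbar hFbar0
  have hqdeg : q.natDegree ≤ r := natDegree_dehomLine_le r Fbar
  let S : Finset (ResidueField R) := T.image fun t => -(residue R t)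
  have hS : S.card = T.card := by
    apply Finset.card_image_of_injOn
    intro t ht t' ht' h
    by_contra hne
    apply hT t ht t' ht' hne
    have h' : residue R t = residue R t' := neg_injective h
    rw [← sub_eq_zero, ← map_sub, IsLocalRing.residue_eq_zero_iff] at h'
    exact h'
  have heval : ∀ s ∈ S, q.eval s = 0 := by
    intro s hs
    obtain ⟨t, ht, rfl⟩ := Finset.mem_image.mp hs
    rw [hq, eval_dehomLine hFbar]
    exact hroot t ht
  by_contra hlt
  push Not at hlt
  exact hq0 (Polynomial.eq_zero_of_natDegree_lt_card_of_eval_eq_zero' q S heval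
    (by rw [hS]; omega))

end Main

end Literature.AlgebraicGeometry.Resolution

end
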